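import Summits.Ventures.PercRepro.ExcessOneClass

/-!
# Transport of the trace vocabulary along an embedding of ground sets

Dossier proofs/MINE1-theoremS.md, Addendum 56. For an embedding `e : β ↪ α` and a family `G` of
subsets of `β`, `famMap e G` is the family of the images `s.map e`. Every notion of the lane is
compatible with this transport — differences (`diffs_famMap`), tightness (`tight_famMap_iff`),
the projection, the two parts and the partner family at `e r` (`proj_famMap`, `part0_famMap`,
`partr_famMap`, `partner_famMap`), and the difference families `X`, `Y` (`diffsX_famMap`,
`diffsY_famMap`). For the subtype `{x // x ≠ b}` the reverse direction: a family on `α` whose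
members avoid `b` is the transport of its restriction (`famMap_subtype_image`). These are the
tools of the twin reduction for Conjecture (T) (MSTightConjTTheorem.lean).
-/

namespace PercRepro.MSTight

open Finset
open scoped FinsetFamily

section Transport

variable {β α : Type*} [DecidableEq β] [DecidableEq α]

/-- The transport of a family of subsets of `β` along `e : β ↪ α`. -/
def famMap (e : β ↪ α) (G : Finset (Finset β)) : Finset (Finset α) :=
  G.map (mapEmbedding e).toEmbedding

omit [DecidableEq β] [DecidableEq α] in
/-- Membership in the transport: the images of the members. -/
theorem mem_famMap {e : β ↪ α} {G : Finset (Finset β)} {A : Finset α} :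
    A ∈ famMap e G ↔ ∃ s ∈ G, s.map e = A := by
  unfold famMap
  rw [mem_map]
  simp only [RelEmbedding.coe_toEmbedding, mapEmbedding_apply]

omit [DecidableEq β] [DecidableEq α] in
/-- The image of `s` is in the transport iff `s` is a member. -/
theorem map_mem_famMap {e : β ↪ α} {G : Finset (Finset β)} {s : Finset β} :
    s.map e ∈ famMap e G ↔ s ∈ G := by
  rw [mem_famMap]
  constructor
  · rintro ⟨t, ht, hts⟩
    rw [map_inj] at hts
    exact hts ▸ ht
  · intro hs
    exact ⟨s, hs, rfl⟩

omit [DecidableEq β] [DecidableEq α] in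
/-- The image of a member is in the transport. -/
theorem map_mem_famMap_of_mem {e : β ↪ α} {G : Finset (Finset β)} {s : Finset β} (hs : s ∈ G) :
    s.map e ∈ famMap e G :=
  map_mem_famMap.2 hs

omit [DecidableEq β] [DecidableEq α] in
/-- The transport has the same number of members. -/
theorem card_famMap (e : β ↪ α) (G : Finset (Finset β)) : (famMap e G).card = G.card :=
  card_map _

/-- The transport of a union. -/
theorem famMap_union (e : β ↪ α) (G₁ G₂ : Finset (Finset β)) :
    famMap e (G₁ ∪ G₂) = famMap e G₁ ∪ famMap e G₂ :=
  map_union _ _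

/-- The transport of an intersection. -/
theorem famMap_inter (e : β ↪ α) (G₁ G₂ : Finset (Finset β)) :
    famMap e (G₁ ∩ G₂) = famMap e G₁ ∩ famMap e G₂ :=
  map_inter _ _

omit [DecidableEq β] [DecidableEq α] in
/-- Inclusion transports. -/
theorem famMap_subset_famMap {e : β ↪ α} {G₁ G₂ : Finset (Finset β)} :
    famMap e G₁ ⊆ famMap e G₂ ↔ G₁ ⊆ G₂ :=
  map_subset_map

/-- Differences transport. -/
theorem diffs_famMap (e : β ↪ α) (G₁ G₂ : Finset (Finset β)) :
    famMap e G₁ \\ famMap e G₂ = famMap e (G₁ \\ G₂) := by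
  ext A
  simp only [mem_diffs, mem_famMap]
  constructor
  · rintro ⟨_, ⟨s, hs, rfl⟩, _, ⟨t, ht, rfl⟩, rfl⟩
    exact ⟨s \ t, ⟨s, hs, t, ht, rfl⟩, Finset.map_sdiff s t⟩
  · rintro ⟨d, ⟨s, hs, t, ht, rfl⟩, rfl⟩
    exact ⟨s.map e, ⟨s, hs, rfl⟩, t.map e, ⟨t, ht, rfl⟩, (Finset.map_sdiff s t).symm⟩

/-- Tightness transports. -/
theorem tight_famMap_iff (e : β ↪ α) (G : Finset (Finset β)) : Tight (famMap e G) ↔ Tight G := by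
  unfold Tight
  rw [diffs_famMap, card_famMap, card_famMap]

/-- The excess-one condition transports. -/
theorem card_diffs_famMap_eq_iff (e : β ↪ α) (G : Finset (Finset β)) :
    (famMap e G \\ famMap e G).card = (famMap e G).card + 1 ↔ (G \\ G).card = G.card + 1 := by
  rw [diffs_famMap, card_famMap, card_famMap]

/-- The projection transports. -/
theorem proj_famMap (e : β ↪ α) (r : β) (G : Finset (Finset β)) :
    proj (e r) (famMap e G) = famMap e (proj r G) := by
  ext A
  simp only [mem_proj, mem_famMap]
  constructor
  · rintro ⟨_, ⟨s, hs, rfl⟩, rfl⟩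
    exact ⟨s.erase r, ⟨s, hs, rfl⟩, map_erase e s r⟩
  · rintro ⟨_, ⟨s, hs, rfl⟩, rfl⟩
    exact ⟨s.map e, ⟨s, hs, rfl⟩, (map_erase e s r).symm⟩

/-- The `r`-free part transports. -/
theorem part0_famMap (e : β ↪ α) (r : β) (G : Finset (Finset β)) :
    part0 (e r) (famMap e G) = famMap e (part0 r G) := by
  ext A
  simp only [mem_part0, mem_famMap]
  constructor
  · rintro ⟨⟨s, hs, rfl⟩, hr⟩
    exact ⟨s, ⟨hs, fun h => hr (mem_map_of_mem e h)⟩, rfl⟩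
  · rintro ⟨s, ⟨hs, hr⟩, rfl⟩
    exact ⟨⟨s, hs, rfl⟩, fun h => hr ((mem_map' e).1 h)⟩

/-- The `r`-part transports. -/
theorem partr_famMap (e : β ↪ α) (r : β) (G : Finset (Finset β)) :
    partr (e r) (famMap e G) = famMap e (partr r G) := by
  ext A
  simp only [mem_partr, mem_famMap]
  constructor
  · rintro ⟨hr, s, hs, hA⟩
    have hrs : r ∈ s := (mem_map' e).1 (hA ▸ mem_insert_self (e r) A)
    refine ⟨s.erase r, ⟨notMem_erase r s, by rw [insert_erase hrs]; exact hs⟩, ?_⟩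
    rw [map_erase, hA, erase_insert hr]
  · rintro ⟨s, ⟨hr, hs⟩, rfl⟩
    exact ⟨fun h => hr ((mem_map' e).1 h), insert r s, hs, map_insert e r s⟩

/-- The partner family transports. -/
theorem partner_famMap (e : β ↪ α) (r : β) (G : Finset (Finset β)) :
    partner (e r) (famMap e G) = famMap e (partner r G) := by
  unfold partner
  rw [part0_famMap, partr_famMap, famMap_inter]

/-- `X` transports. -/
theorem diffsX_famMap (e : β ↪ α) (r : β) (G : Finset (Finset β)) :
    diffsX (e r) (famMap e G) = famMap e (diffsX r G) := by
  unfold diffsX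
  rw [part0_famMap, partr_famMap, diffs_famMap, diffs_famMap, diffs_famMap, famMap_union,
    famMap_union]

/-- `Y` transports. -/
theorem diffsY_famMap (e : β ↪ α) (r : β) (G : Finset (Finset β)) :
    diffsY (e r) (famMap e G) = famMap e (diffsY r G) := by
  unfold diffsY
  rw [part0_famMap, partr_famMap, diffs_famMap]

/-- Conjecture (T) transports back. -/
theorem diffsY_subset_diffsX_of_famMap {e : β ↪ α} {r : β} {G : Finset (Finset β)}
    (h : diffsY r G ⊆ diffsX r G) : diffsY (e r) (famMap e G) ⊆ diffsX (e r) (famMap e G) := by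
  rw [diffsY_famMap, diffsX_famMap]
  exact famMap_subset_famMap.2 h

end Transport

section Subtype

variable {α : Type*} [DecidableEq α]

/-- A family on `α` whose members avoid `b` is the transport of its restriction to `{x // x ≠ b}`.
-/
theorem famMap_subtype_image {b : α} {G : Finset (Finset α)} (hG : ∀ s ∈ G, b ∉ s) :
    famMap (Function.Embedding.subtype (· ≠ b)) (G.image (Finset.subtype (· ≠ b))) = G := by
  ext A
  rw [mem_famMap]
  constructor
  · rintro ⟨s, hs, rfl⟩
    obtain ⟨t, ht, rfl⟩ := mem_image.1 hs
    rw [subtype_map, filter_true_of_mem (p := (· ≠ b)) (fun x hx (hxb : x = b) => hG t ht (hxb ▸ hx))]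
    exact ht
  · intro hA
    refine ⟨A.subtype (· ≠ b), mem_image_of_mem _ hA, ?_⟩
    rw [subtype_map, filter_true_of_mem (p := (· ≠ b)) (fun x hx (hxb : x = b) => hG A hA (hxb ▸ hx))]

/-- Membership in the restriction. -/
theorem mem_subtype_image {b : α} {G : Finset (Finset α)} (hG : ∀ s ∈ G, b ∉ s)
    {s : Finset {x // x ≠ b}} :
    s ∈ G.image (Finset.subtype (· ≠ b)) ↔ s.map (Function.Embedding.subtype (· ≠ b)) ∈ G := by
  constructor
  · intro hs
    have h := map_mem_famMap_of_mem (e := Function.Embedding.subtype (· ≠ b)) hs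
    rwa [famMap_subtype_image hG] at h
  · intro hs
    rw [← famMap_subtype_image hG] at hs
    exact map_mem_famMap.1 hs

end Subtype

end PercRepro.MSTight
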